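import Mathlib.RingTheory.KrullDimension.Basic
import Mathlib.RingTheory.IntegralClosure.IntegrallyClosed
import Mathlib.Tactic.FinCases
import Literature.Computability.AlgebraicComplexity.GCTProofs
import Literature.Computability.AlgebraicComplexity.OrbitClosureProofs
import Literature.Computability.AlgebraicComplexity.OrbitCoordinateRing
import Literature.Computability.AlgebraicComplexity.PolystabilityProofs
import Literature.Computability.AlgebraicComplexity.CharacterizedByStabilizer
import Literature.Computability.AlgebraicComplexity.DeterminantalComplexityProofs
import Literature.Computability.AlgebraicComplexity.StandardFamiliesProofs
import Literature.Computability.AlgebraicComplexity.MignonRessayreBound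
import Literature.Computability.AlgebraicComplexity.PermanentVsDeterminantProofs
import Literature.Computability.AlgebraicComplexity.AlperBogartVelascoProofs
import Literature.Computability.AlgebraicComplexity.BorderDcQuadraticBoundProofs
import Literature.Computability.Complexity.OccurrenceObstructionsModuleForm
import Literature.NumberTheory.DiophantineGeometry.DetOrbitSymKroneckerBound
import Literature.Barriers.ValiantsHypothesis.GCTUsefulModules
import Literature.LinearAlgebra.Matrix.PermanentSubperm
import Literature.LinearAlgebra.Matrix.SymmetricCongruenceRank
import HarnessLib

/-!
# Bürgisser 2024 (survey), §7 «Geometric complexity theory» and §2.9 «Determinantal complexity» —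
typed against the tree (cell `val-lit`, DAG row Bur24-A, typer t09)

Source: P. Bürgisser, *Completeness classes in algebraic complexity theory*, arXiv:2406.06217
(2024) [Burgisser2024Completeness], §7.1–§7.6 (held text `paper:arxiv-2406.06217`, chunks
p0027–p0031) and §2.9 (chunk p0012). Locators below are «§ / printed number, pNNNN.txt:Lnn» of
that held text (`lit read arxiv:2406.06217`). Honest framing (cell val-lit): typed literature and
bookkeeping; `VP ≠ VNP` / `VNP ⊄ \overline{VBP}` are NOT proved and nothing here is progress on
them; the survey's open problems are recorded as POINTERS to the places where the tree already
states them (no new conjecture is introduced into `Literature/`).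

§7 of the survey is an overview: almost every displayed statement restates a result that the tree
already PROVES or vendors. This file is the CHECK of record — each survey statement is either
(a) a one-line `theorem` in the survey's numbering whose proof IS the existing tree declaration
(kernel-checked crosswalk, FACT-LIST R4), or (b) a NEW named fact (`def … : Prop`, D-0014) for the
few quoted results the tree lacks, or (c) a docstring pointer when the statement belongs to
another typer's section file (BLMW11, BI17, IP17, CKRST20 rows) or is an open problem already
typed elsewhere.

## Crosswalk §7 (survey item → tree), in source order

* §7.1 «every rational group homomorphism `GL_n → ℂ^*` is `det^k`» (p0027:L37–40) — prose remark,
  not typed (no bearing on the rungs). «Frobenius [Frobdet]: each element of `H = stab(det_n)` is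
  `g_{A,B}` or `τ g_{A,B}`», (7.1) `H ≃ (SL_n × SL_n)/μ_n ⋊ ℤ₂` (p0027:L70–84) — PROVED in tree in
  the Marcus–Moyls/Landsberg normalisation:
  `Literature.NumberTheory.DiophantineGeometry.frobenius_detPreserver_unimodular_sandwich_holds`
  (`DetStabilizerFrobenius(Proofs).lean`); the group-isomorphism form (7.1) itself is not typed.
  «`H ⊆ stab(f) ⟹ ∃ z, f = z det_n`» (p0027:L88–93) — PROVED: `detPoly_isCharacterizedByStabilizer_holds`
  (`CharacterizedByStabilizer.lean`); alias `Bur24_detPoly_characterizedByStabilizer` below.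
  «`stab(f) = μ_n` for generic `f` [buik:15]» — Bürgisser–Ikenmeyer 2017 = DAG row BI17-A (t04's
  file), not typed here. Remark 7.1 (Makam–Wigderson 2021: `Sing_{n,m}` is not a null cone) — not
  typed (null-cone vocabulary absent; source not in this cell's list); GAP note on the bus.
* §7.2 `Ω_n^o := GL_{n²}·det_n`, `Ω_n := \overline{Ω_n^o}` (7.2) — tree: `glOrbit`, `orbitClosure`
  (`LinSubst.lean`, `OrbitClosure.lean`). «Euclidean closure = Zariski closure» — PROVED:
  `orbitClosure_eq_euclidean_closure_complex_holds` (`OrbitClosureEuclidean.lean`).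
  «`dim Ω_n = dim GL_{n²} − dim H = n⁴ − 2n² + 2`» (p0027:L104–p0028:L1) — NEW FACT
  `Bur24_dim_detOrbitClosure`. «for `n = 2`, `Ω_2 = Sym²(ℂ^{2×2})^*`» (p0028:L2) — NEW FACT
  `Bur24_detOrbitClosure_two` (DISCHARGEABLE: diagonalisation of quadratic forms over `ℂ` plus
  `endOrbit_subset_orbitClosure_holds`). «`∂Ω_n` is a hypersurface in `Ω_n` [BLMW:11]», «zero set
  of the fundamental invariant [buik:15]» — rows BLMW11-A (t03) / BI17-A (t04), not typed here.
  «[kuma:10] `Ω_n` is not normal if `n > 2`» (p0028:L14) — NEW FACTS `Kumar2013_thm_3_8` (det),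
  `Kumar2013_thm_4_5` (per), `Kumar2013_thm_8_4` (padded per), typed from the held original
  (`paper:arxiv-1007.1695`) and Landsberg 2017 Thm. 10.3.2.1. «for `n = 3` the boundary has two
  irreducible components [lahu:16]; the boundary of `Ω_4` is already unknown» (p0028:L17–20) —
  Hüttenhain–Lairez 2016 = Landsberg 2017 Thm. 6.7.2.5, whose component `\overline{GL_9·P_Λ}` is
  Landsberg Prop. 6.7.2.2 [LMR13] = DAG row LMR13 (t11, §3.5); not typed here (needs `P_Λ`), GAP
  note on the bus; «boundary of `Ω_4` unknown» is an open PROBLEM (not Prop-shaped), recorded only.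
  **Theorem 7.2** («the orbit of `det_n` under `SL_{n²}` is closed», p0028:L28–29) — PROVED:
  `BurgisserIkenmeyer2017_polystable_det_per_holds`; alias `Bur24_thm_7_2`. (7.3)–display
  «`t^{n−m} per_m ∈ Ω_n` whenever `per_m = det(A(X))`, `A` of size `n` affine linear, `m < n`»
  (p0028:L31–62) — PROVED: `paddedPerPoly_mem_orbitClosure_detPoly_of_hasDetRepr_holds`; alias
  `Bur24_hasBorderDetRepr_of_hasDetRepr`. **Conjecture 7.1** (Mulmuley–Sohoni: «for all `c ≥ 1`,
  `t^{m^c−m} per_m ∉ Ω_{m^c}` for infinitely many `m`», p0028:L66–69) — ALREADY TYPED as the open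
  statements `BorderDcPerSuperpolynomial` / `MulmuleySohoniConjecture` (`GCT.lean`, `@[conjecture]`,
  never asserted); not restated. **Theorem 7.3** ([BLMW:11]: Conj. 7.1 ⟺ `VNP ⊄ \overline{VBP}`,
  p0028:L82–84) — the tree has no class `\overline{VBP}`; its proxy is «`\underline{dc}(per_n)` not
  p-bounded», and `BorderDcPerSuperpolynomial ↔ ¬ IsPBounded (borderDetComplexityPer ℂ)` is PROVED
  (`borderDcPerSuperpolynomial_iff_not_isPBounded`, `GCTProofs.lean`) — CITED, not restated (an alias would be
  a verbatim duplicate).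
  The class-level equivalence (BLMW 2011 Prop. 9.2, VNP-completeness of `per` under p-projections
  + closure of `\overline{VBP}`) is row BLMW11-B (t03); GAP: no `VBP`/`\overline{VBP}` class in
  `ValiantClasses.lean` (FACT-LIST R5 definition item, reported on the bus).
* §7.3 «Explicit equations for VP?». Strassen's method [stra:74-1] and the claim «the statement of
  Conj. 7.1 can be proved when `per_m` is replaced by `f = Σ_π c(π) x_{1π(1)}⋯x_{mπ(m)}` with
  `(c(π))` a permutation of `(√1, …, √m!)`» (p0028:L88–111) — asserted with a proof sketch, no
  theorem statement printed there or located in [buer:00-3] (presearch, bus); NOT vendored (a fact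
  must cite a printed proof). «algebraic natural proofs [grochow-et-al, forbes-et-al] ↔ efficiently
  computable equations for `VP`» — tree: `Literature.Barriers.ValiantsHypothesis.SuccinctHittingSetsForVP`,
  `algebraicNaturalProofs_holds`, `not_naturalProofAgainstVP` (`AlgebraicNaturalProofs.lean`).
  «[chatterjee-et-al:20] equations for `VP`, `VNP` with small integer coefficients» — row CKRST20-A
  (t20). «[kumar-eq-VNP:22] `VNP` has no equations in `VP` if `per` is hard» — PROVED:
  `Literature.Barriers.ValiantsHypothesis.not_exists_isNaturalProof_smallDefinable_of_permanentExpHard`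
  (route item 18971 `KRST2022` CLOSED). OPEN QUESTION «The proof does not appear to extend to `VP`»
  (p0028:L128) = route item stmt-ValiantsHypothesis-18967 `…Theses.BarrierLever.KRSTForVP` and crux
  14610 `SuccinctHittingSetsForVP` (Summits side) — pointers only.
* §7.4 «multiplicities only drop under surjective module morphisms» (7.5), «`h ∈ Ω_n` ⟹
  `∀ λ ⊢ dn, mult_h(λ) ≤ K_n(λ)`» (7.9) — PROVED: `not_hasMultiplicityObstruction_of_mem_orbitClosure`
  (`GCTObstructions.lean`, intertwiner form) and `orbitMultiplicity_le_of_mem_orbitClosure_holds`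
  (`MultiplicityObstructionsProofs.lean`, weight form). Plethysm decomposition (7.6), «`K_n(λ) ≤
  pleth_n(λ)`» — tree `Literature.NumberTheory.DiophantineGeometry.plethysmCoeff`, `orbitMultiplicity`
  (`SchurWeylPlethysm.lean`), PROVED `orbitMultiplicity_le_plethysmCoeff_holds`. «positivity of
  plethysm coefficients is NP-hard [ikenmeyer-fischer:20]», LR positivity in P, GCT6 refuted for
  Kronecker [ik-m-w:15]» — PROVED: `Literature.Barriers.ValiantsHypothesis.FischerIkenmeyer2020_plethysmNPHard_holds`,
  `IMW2017_kroneckerNPHard_holds`, `KroneckerPlethysmHardness_holds`. «representation theoretic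
  obstruction» — tree `HasMultiplicityObstruction`, `PerDetMultiplicityObstruction(At)`.
  OPEN QUESTION «it is unclear whether representation theoretic obstructions are necessary. Any
  result on the principal feasibility of this strategy would be highly welcome!» (p0030:L10–13) —
  typed Summits-side as the hypothesis-shaped Props `Summit.PneNP.GCT.MultObstructionPer3Det4`
  (stmt-19612, rung V3), `MultObstructionsBeyondPoly` / `…BeyondQuasiPoly` (`SufficesForValiant.lean`),
  route items 0325 `GctMultObstructions`, 0890 `GctNoMultBarrier`; pointer only. «test the strategy
  on `PS_n` (power sums) [DIP20, IK20]» — tree `DIP2020_thm_2_3_1` (fact), `IK2020_thm_4_3_holds`.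
* §7.5 «occurrence obstructions» — tree `HasOccurrenceObstruction`. **Theorem 7.4** (BIP 2019:
  `n ≥ m^25`, `mult_h(λ) > 0 ⟹ K_n(λ) > 0`, p0030:L49–52) — PROVED:
  `Literature.Computability.Complexity.bip2019_not_hasOccurrenceObstruction_holds` (and the barrier
  entries `Literature.Barriers.{PneNP,ValiantsHypothesis}.GCTOccurrenceObstructions_holds`); alias
  `Bur24_thm_7_4` (BIP's padding by `X₀₀` of `per_m`; the survey's `t` is a fresh variable — for
  that padding the printed proof gives threshold `(m+1)^25`, tree
  `Literature.Computability.Complexity.no_occurrence_obstructions_succ_of_parts`; caveat recorded,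
  not smoothed over). **Proposition 7.5** (Kadish–Landsberg: `mult_h(λ) > 0 ⟹ ℓ(λ) ≤ ℓ+1 ∧
  λ₁ ≥ |λ|(1 − m/n)`, p0030:L63–66) — PROVED for `f = per` as
  `Literature.Barriers.ValiantsHypothesis.exists_presentation_long_row_of_hasHighestWeight` (from
  `kadish_landsberg_padding_holds`, `exists_partition_of_hasHighestWeight_paddedPerOrbitRep_holds`);
  alias `Bur24_prop_7_5_per`. (7.11) `ℂ[Ω_n^o]_d`, «`K_n(λ) ≤ k_n(λ)`», (7.12) Peter–Weyl
  «`k_n(λ) = dim V_λ^H`» — the ORBIT (non-closure) coordinate ring is not an object of the tree; row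
  BLMW11-A (t03, BLMW §4–§5). Kronecker coefficients — tree
  `Literature.NumberTheory.DiophantineGeometry.kroneckerCoeff`. **Theorem 7.6** («`k_n(λ) ≤
  k(λ, n×d, n×d)`; `k_n(λ)` = dimension of the swap-invariant `S_{nd}`-invariants», p0030:L122–128)
  — the CLOSURE-side consequence `K_n(λ) ≤ sk(λ, n×d) ≤ k(λ, n×d, n×d)` is PROVED:
  `orbitMultiplicity_det_le_symKroneckerCoeffRect`, `symKroneckerCoeffRect_le_kroneckerCoeff`
  (`DetOrbitSymKroneckerBound.lean`); alias `Bur24_thm_7_6_closureForm`; the orbit-ring EQUALITY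
  is BLMW Prop. 5.2.1 (5.2.6) = row BLMW11-A. «[ik-panova:15] `n > 3m⁴`, `mult_h(λ) > 0 ⟹
  k_n(λ) > 0`» (p0030:L143–146) — row IP17-A (t05, `BAR/IP17RectangularKronecker.lean`). IMM:
  OPEN QUESTION «It is unknown whether the method of occurrence obstructions can achieve this»
  (p0031:L22) — ALREADY TYPED `Literature.Barriers.PneNP.IMMOccurrenceObstructionConjecture`
  (`@[conjecture]`), with `PowOccurrenceObstructionConjecture`; matrix powering
  [gesmundo-ikenmeyer-panova:17] — PROVED `Literature.Barriers.ValiantsHypothesis.GIP2017_pc_le_holds`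
  (`GCTMatrixPowering*.lean`). «[BI:10, BI:13] `R̲(M_m) ≥ 3/2 m² − 2` via occurrence obstructions»
  — PROVED (by Koszul flattenings) `BurgisserIkenmeyer2013_thm_4_5`; «best known
  `2m² − log₂ m − 1` [landsberg-michalek:18]» — fact `LandsbergMichalek2018_borderRank_matMulTensor`;
  Landsberg–Ottaviani — PROVED `LandsbergOttaviani2015_algBorderRank_matMulTensor`.
* §7.6 Summary and outlook (p0031:L40–46) — no statements.

## Crosswalk §2.9 (CHECK)

* Pólya 1913 / Szegő 1913 (no sign matrix, `n ≥ 3`) — PROVED `not_exists_scalar_sign_twist`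
  (`PolyaPermanentConversion.lean`). Marcus–Minc 1961 («no matrix `[f_pq]` of linear forms with
  `per_n = det[f_pq]`», p0012:L68–71) — ABSENT as a statement; PROVED below over `ℂ`
  (`Bur24_marcusMinc_complex`) from the tree's `dc` bounds (not by the 1961 argument).
* **Definition 2.35** (`dc(f)`, `dc(n) := dc(PER_n)`) — tree `determinantalComplexity`
  (`DeterminantalComplexity.lean`): «least `s` with `f = det A`, `A` an `s × s` matrix of affine
  linear forms» — FAITHFUL (entries `totalDegree ≤ 1`; `sInf`, attained by `exists_hasDetRepr_holds`).
* «`dc(f) ≤ E(f) + 1`» (Prop. 2.23) — tree `DeterminantalComplexityProofs.lean` (universality of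
  the determinant, Bürgisser 2000 Prop. 2.30; cited there as Bürgisser 2024 Prop. 2.23).
  «Grenet: `dc(n) ≤ 2^n − 1`» — PROVED `determinantalComplexity_perPoly_le_holds`; alias
  `Bur24_dc_le_grenet`. «`dc(3) ≤ 7` optimal [hu-ik:14, alper-et-al]» — PROVED
  `alperBogartVelasco2017_cor_1_4_holds` (`dc(per_3) = 7 ∧ 9 ≤ dc(per_4)`, char ≠ 2) — CITED, not restated
  (the `ℂ` instance is the Summits-side `…Theorems.DetqpThesis.Negative.dcPer_three`). «`dc(2) = 2`» — PROVED below,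
  `Bur24_dc_two` (Literature home; the Summits-side route file `…Theorems.DetqpThesis.Negative.Variants`
  proves the same as `dcPer_two`, which Literature cannot import). «Landsberg–Ressayre: Grenet optimal among half-symmetric representations» —
  PROVED `lr_left_equivariant_lower_holds` (row LR17, t12).
* «`VBP ≠ VNP` iff `dc(n)` not polynomially bounded (char ≠ 2)» — the tree's proxy statement is
  `DcPerSuperpolynomial k` (`PermanentVsDeterminant.lean`); no class `VBP` in `ValiantClasses.lean`
  (GAP, as for Thm. 7.3); `DcPerSuperpolynomial ℂ` follows from `BorderDcPerSuperpolynomial` via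
  `MulmuleySohoniConjecture` only (`dcPerSuperpolynomial_of_mulmuleySohoni_holds`, `GCTProofs.lean`).
* **Theorem 2.36** (Mignon–Ressayre: `dc(n) ≥ n²/2` over `ℂ`) — PROVED
  `sq_le_two_mul_determinantalComplexity_perPoly_complex_holds` (for `n ≥ 3`, as in the source);
  alias `Bur24_thm_2_36`. «[cai-et-al.10] char ≠ 2» — row CCL10 (t17); «[yabe:15] over `ℝ`» — row
  Yab15 (t17); «[la-ma-res:13] border version» — PROVED `LMR2013_thm_1_1_1_holds`; alias
  `Bur24_borderDc_quadratic`.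
* Theorem 2.34 (§2.8, Fisher–Kasteleyn–Temperley: perfect matchings of planar graphs are
  p-computable) — ABSENT; needs planar-graph vocabulary Mathlib lacks (FACT-LIST R5: definition
  item); reported on the bus, not typed.

## What this file declares

New named facts (R1, machinery absent: orbit dimension formula; GIT / Zariski main theorem):
`Bur24_dim_detOrbitClosure`, `Bur24_detOrbitClosure_two` (R2, dischargeable), `Kumar2013_thm_3_8`,
`Kumar2013_thm_4_5`, `Kumar2013_thm_8_4`. Proved here: `Bur24_dc_two`, `Bur24_marcusMinc_complex`,
and the one-line aliases named above. No `instance`, no `notation`, no attribute changes (TYPER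
LINT); no new conjecture.

## References

* [Burgisser2024Completeness] P. Bürgisser, arXiv:2406.06217, §7 (pp. of held text p0027–p0031),
  §2.9 (p0012).
* [Kumar2013] S. Kumar, *Geometry of orbits of permanents and determinants*, Comment. Math. Helv.
  88 (2013) 759–788 = arXiv:1007.1695 (held: `paper:arxiv-1007.1695`), Thm. 3.8 (p0005.txt:L126),
  Thm. 4.5 (p0007.txt:L72), Thm. 8.4 (p0016.txt:L6), Introduction (p0002.txt:L57–58).
* [LandsbergGCT2017] J. M. Landsberg, *Geometry and Complexity Theory*, CUP 2017, Thm. 10.3.2.1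
  (held text p0291), Thm. 6.7.2.5 and Prop. 6.7.2.2 (p0180).
* [MarcusMinc1961] M. Marcus, H. Minc, *On the relation between the determinant and the
  permanent*, Illinois J. Math. 5 (1961) 376–381.
* [HuttenhainLairez2016], [MakamWigderson2021] — cited in the crosswalk only.
-/

noncomputable section

open MvPolynomial

namespace Literature.Computability.AlgebraicComplexity

/-! ### §7.1 Symmetries of the determinant -/

/-- **Bürgisser 2024, §7.1, display after (7.1)**: «It is a remarkable fact that, up to a scaling
factor, `det_n` is uniquely determined by its stabilizer: `H ⊆ stab(f) ⟹ ∃ z ∈ ℂ, f = z det_n`»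
(`paper:arxiv-2406.06217` p0027.txt:L88–93). In the tree's rendering (`CharacterizedByStabilizer.lean`,
`GL`-reading): every degree-`n` form in the `n²` matrix variables over `ℂ` fixed by every
`γ ∈ GL_{n²}(ℂ)` that fixes `det_n` under linear substitution is a scalar multiple of `det_n`.
PROVED in tree (`detPoly_isCharacterizedByStabilizer_holds`); this is the survey-numbered alias.
[cite: Burgisser2024Completeness, §7.1 (display after (7.1))] -/
theorem Bur24_detPoly_characterizedByStabilizer (n : ℕ) :
    IsCharacterizedByStabilizer (detPoly (Fin n) ℂ) n :=
  detPoly_isCharacterizedByStabilizer_holds n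

/-! ### §7.2 Orbit closures -/

-- FACT (R1: dimension of algebraic-group orbits, `dim G·x = dim G − dim G_x`)
/-- **Bürgisser 2024, §7.2** (`paper:arxiv-2406.06217` p0027.txt:L104–p0028.txt:L1): «Note that
`dim Ω_n = dim GL_{n²} − dim H = n⁴ − 2n² + 2`», for the affine cone
`Ω_n = \overline{GL_{n²}·det_n} ⊆ Sym^n(ℂ^{n×n})^*` and `H = stab(det_n)` of dimension `2n² − 2`
((7.1)). Rendering: the Krull dimension of the coordinate ring `ℂ[Ω_n] = ℂ[Sym^n] ⧸ I(GL·det_n)`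
(tree `OrbitCoordRing (detPoly (Fin n) ℂ) n`, `OrbitCoordinateRing.lean`; a domain, `Ω_n` being
irreducible) equals `n⁴ + 2 − 2n²` (written truncation-free; `= n⁴ − 2n² + 2`). Side condition
`1 ≤ n` (for `n = 0`, `det_0 = 1` and the ring is `ℂ`, of dimension `0 ≠ 2`); `n = 1, 2` are
covered (`dim Ω_1 = 1`, `Ω_2 = Sym²(ℂ⁴)^*` of dimension `10`). Named fact (D-0014): the orbit
dimension formula for algebraic group actions is not in the tree.
[cite: Burgisser2024Completeness, §7.2 (dimension formula before Thm. 7.2)] -/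
def Bur24_dim_detOrbitClosure : Prop :=
  ∀ n : ℕ, 1 ≤ n →
    ringKrullDim (OrbitCoordRing (detPoly (Fin n) ℂ) n) = ((n ^ 4 + 2 - 2 * n ^ 2 : ℕ) : WithBot ℕ∞)

-- DISCHARGEABLE (R2: diagonalisation of complex quadratic forms + `endOrbit_subset_orbitClosure_holds`)
/-- **Bürgisser 2024, §7.2** (`paper:arxiv-2406.06217` p0028.txt:L2): «We may assume `n > 3` [sic]
since for `n = 2` we have `Ω_2 = Sym²(ℂ^{2×2})^*`» — the orbit closure of the `2 × 2` determinant
(a non-degenerate quadratic form in `4` variables) is the whole space of quadratic forms in the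
`4` matrix variables. Rendering with the tree's `orbitClosure` (a set of polynomials; every
degeneration of a degree-`2` form is a degree-`2` form, and conversely every quadratic form in
`4` variables over `ℂ` is `det_2 ∘ A` for some — possibly singular — linear map `A`, hence lies
in `End·det_2 ⊆ \overline{GL·det_2}`). Named fact, dischargeable in tree vocabulary
(`endOrbit_subset_orbitClosure_holds`, `QuadraticForm.equivalent_weightedSumSquares`).
[cite: Burgisser2024Completeness, §7.2 (remark before Thm. 7.2)] -/
def Bur24_detOrbitClosure_two : Prop :=
  orbitClosure (detPoly (Fin 2) ℂ) = {f : MvPolynomial (Fin 2 × Fin 2) ℂ | f.IsHomogeneous 2}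

-- FACT (R1: GIT quotients, Zariski's main theorem)
/-- **Kumar 2013, Theorem 3.8** (`paper:arxiv-1007.1695` p0005.txt:L126): «For any `m ≥ 3`,
`𝒳 = \overline{G·det}` is not normal», where `E = End 𝔳` (`dim 𝔳 = m`), `det ∈ Q = S^m(E^*)`,
`G = GL(E)` acting by `(g·q)(X) = q(gᵗ X)` (p0002.txt:L1–21); quoted in Bürgisser 2024 §7.2 as
«We also know [kuma:10] that `Ω_n` is not a normal variety if `n > 2`» (`paper:arxiv-2406.06217`
p0028.txt:L14) and restated as Landsberg 2017 Thm. 10.3.2.1 («For all `n ≥ 3`, `𝒟et_n` … [is]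
not normal»). Rendering: `Ω_m` is irreducible, so «normal» = «its coordinate ring is an integrally
closed domain»; the statement is `¬ IsIntegrallyClosed ℂ[Ω_m]` for the tree's
`OrbitCoordRing (detPoly (Fin m) ℂ) m` (the orbit under linear substitution of the `m²`
variables is the same set for either side convention). Named fact (D-0014).
[cite: Kumar2013, Thm. 3.8 (arXiv:1007.1695 numbering)] [cite: LandsbergGCT2017, Thm. 10.3.2.1]
[cite: Burgisser2024Completeness, §7.2] -/
def Kumar2013_thm_3_8 : Prop :=
  ∀ m : ℕ, 3 ≤ m → ¬ IsIntegrallyClosed (OrbitCoordRing (detPoly (Fin m) ℂ) m)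

-- FACT (R1)
/-- **Kumar 2013, Theorem 4.5** (`paper:arxiv-1007.1695` p0007.txt:L72): «For `n ≥ 3`, the
subvariety `\overline{GL(End 𝔳₁)·perm} ⊂ S^n((End 𝔳₁)^*)` is not normal» (`dim 𝔳₁ = n`, the
UNPADDED permanent under `GL_{n²}`); Landsberg 2017 Thm. 10.3.2.1: «`𝒫erm_n^n =
\overline{GL_{n²}·[perm_n]}` [is] not normal». Rendering as for `Kumar2013_thm_3_8`, with the
tree's `perPoly (Fin n) ℂ`. Named fact (D-0014).
[cite: Kumar2013, Thm. 4.5 (arXiv:1007.1695 numbering)] [cite: LandsbergGCT2017, Thm. 10.3.2.1] -/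
def Kumar2013_thm_4_5 : Prop :=
  ∀ n : ℕ, 3 ≤ n → ¬ IsIntegrallyClosed (OrbitCoordRing (perPoly (Fin n) ℂ) n)

-- FACT (R1)
/-- **Kumar 2013, Theorem 8.4** (`paper:arxiv-1007.1695` p0016.txt:L6): «Let `m ≥ 2n`. Then
`\overline{G·𝔭}` is not normal», where `𝔭(X) = x_{1,1}^{m−n} perm(X^o)`, `X^o` the bottom-right
`n × n` corner of the `m × m` matrix `X` (p0002.txt:L5–12) — exactly the tree's padded permanent
`paddedPerPoly ℂ n m` (`per_n` on the bottom-right block, padding variable `X₀₀`) — and `G =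
GL_{m²}`; the Introduction states the range as «for any `m ≥ 2n` and `n ≥ 3`» (p0002.txt:L57–58),
and both side conditions are kept here (Landsberg 2017 Thm. 10.3.2.1 prints «For all `n ≥ 2m`
(the range of interest), `𝒫erm_n^m` is not normal» in his letters, without the `m ≥ 3` of Kumar's
Introduction; the weaker = safer reading is vendored). Named fact (D-0014).
[cite: Kumar2013, Thm. 8.4 and Introduction (arXiv:1007.1695 numbering)]
[cite: LandsbergGCT2017, Thm. 10.3.2.1] -/
def Kumar2013_thm_8_4 : Prop :=
  ∀ (n m : ℕ) [NeZero m], 3 ≤ n → 2 * n ≤ m →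
    ¬ IsIntegrallyClosed (OrbitCoordRing (paddedPerPoly ℂ n m) m)

/-- **Bürgisser 2024, Theorem 7.2** (`paper:arxiv-2406.06217` p0028.txt:L28–29): «The orbit of
`det_n` under the action of `SL_{n²}` is closed» ([gct1]; Hilbert–Mumford/Kempf, [buik:15]).
PROVED in tree as the `det` clause of Bürgisser–Ikenmeyer 2017 Cor. 2.9
(`BurgisserIkenmeyer2017_polystable_det_per_holds`, `PolystabilityProofs.lean`; `IsPolystable` =
the `SL`-orbit is Zariski closed in coefficient space). Survey-numbered alias.
[cite: Burgisser2024Completeness, Thm. 7.2] [cite: BurgisserIkenmeyer2017, Cor. 2.9] -/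
theorem Bur24_thm_7_2 (n : ℕ) : IsPolystable (detPoly (Fin n) ℂ) :=
  (BurgisserIkenmeyer2017_polystable_det_per_holds n).1

/-- **Bürgisser 2024, §7.2, (7.3) and the display `t^{n−m} per_m ∈ Ω_n`**
(`paper:arxiv-2406.06217` p0028.txt:L31–62): if `per_m = det(A(X))` with `A` of size `n ≥ m`
with affine linear entries, then the padded permanent lies in `Ω_n` (homogenise, append zero
columns, approximate by invertible substitutions). PROVED in tree
(`paddedPerPoly_mem_orbitClosure_detPoly_of_hasDetRepr_holds`, Mulmuley–Sohoni 2001 Prop. 4.4),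
here over `ℂ` in the survey's letters swapped to the tree's (`per_n`, `det_m`): an affine
determinantal representation of `per_n` of size `m ≥ n` gives `HasBorderDetRepr ℂ n m`.
[cite: Burgisser2024Completeness, §7.2 (7.3)] [cite: MulmuleySohoniSIAM2001, Prop. 4.4] -/
theorem Bur24_hasBorderDetRepr_of_hasDetRepr {n m : ℕ} [NeZero m]
    (h : HasDetRepr (perPoly (Fin n) ℂ) m) (hnm : n ≤ m) : HasBorderDetRepr ℂ n m :=
  paddedPerPoly_mem_orbitClosure_detPoly_of_hasDetRepr_holds h hnm

/-! ### §7.4 Representation theoretic obstructions -/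

/-- **Bürgisser 2024, Theorem 7.6, closure form** (`paper:arxiv-2406.06217` p0030.txt:L122–128 with
«Obviously, `K_n(λ) ≤ k_n(λ)`», L88): the gct-multiplicity of `λ ⊢ dn` in `ℂ[Ω_n]_d` is at most the
rectangular Kronecker coefficient `k(λ, n×d, n×d)` — in fact at most the symmetric one, the
dimension of the `S_{nd}`-invariants of `[λ] ⊗ [n×d] ⊗ [n×d]` invariant under swapping the last two
factors. PROVED in tree for the orbit CLOSURE (which is what (7.9) uses):
`orbitMultiplicity_det_le_symKroneckerCoeffRect` and `symKroneckerCoeffRect_le_kroneckerCoeff`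
(`DetOrbitSymKroneckerBound.lean`; BLMW 2011 Prop. 5.2.1), composed here in the tree's letters
(`det_m`, `λ ⊢ m·d`, `ℓ(λ) ≤ m²`, weight `λ*` for the lexicographic Borel). The survey's statement
about the ORBIT ring `ℂ[Ω_n^o]` (equality `k_n(λ) = sk`, Peter–Weyl) is not an object of the tree
(row BLMW11-A). [cite: Burgisser2024Completeness, Thm. 7.6] [cite: BLMW2011, §5.2 Prop. 5.2.1] -/
theorem Bur24_thm_7_6_closureForm (m : ℕ) {d : ℕ} (lam : Nat.Partition (m * d))
    (hlam : lam.parts.card ≤ m * m) :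
    Literature.NumberTheory.DiophantineGeometry.orbitMultiplicity ℂ
        (Literature.NumberTheory.DiophantineGeometry.detFormLex ℂ m) m
        (Literature.NumberTheory.DiophantineGeometry.Weight.dualOfPartition (m * m) lam).toMatIdx ≤
      Literature.NumberTheory.DiophantineGeometry.kroneckerCoeff ℂ lam
        (Nat.Partition.rectangle m d) (Nat.Partition.rectangle m d) :=
  (Literature.NumberTheory.DiophantineGeometry.orbitMultiplicity_det_le_symKroneckerCoeffRect ℂ m
      lam hlam).trans
    (Literature.NumberTheory.DiophantineGeometry.symKroneckerCoeffRect_le_kroneckerCoeff ℂ lam hlam)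

/-! ### §7.5 Occurrence obstructions -/

/-- **Bürgisser 2024, Theorem 7.4** (`paper:arxiv-2406.06217` p0030.txt:L49–52; = Bürgisser–
Ikenmeyer–Panova 2019 Thm. 1.4): «Let `n ≥ m^25` and `h := t^{n−m} per_m`. If `λ ⊢ nd` satisfies
`mult_h(λ) > 0`, then `K_n(λ) > 0`» — no occurrence obstructions. PROVED in tree
(`Literature.Computability.Complexity.bip2019_not_hasOccurrenceObstruction_holds`), stated with
BIP's own padding `X₀₀^{m-n} per_n` (padding variable taken FROM the permanent's block,
`bipPaddedPerPoly`), in tree letters (`per_n`, `det_m`, `n ≥ 1`, `d ≥ 1`, `n^25 ≤ m`). Caveat, as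
printed in the tree and not smoothed over here: the survey's `t` is a variable outside the block;
for that padding (`paddedPerPoly`) the printed proof yields the threshold `(n+1)^25`
(`Literature.Computability.Complexity.no_occurrence_obstructions_succ_of_parts`).
[cite: Burgisser2024Completeness, Thm. 7.4] [cite: BurgisserIkenmeyerPanovaJAMS2019, Thm. 1.4] -/
theorem Bur24_thm_7_4 {n m d : ℕ} [NeZero m] (hn : 1 ≤ n) (hd : 1 ≤ d) (hnm : n ^ 25 ≤ m) :
    ¬ HasOccurrenceObstruction (detPoly (Fin m) ℂ)
        (Literature.Computability.Complexity.bipPaddedPerPoly ℂ n m) m d :=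
  Literature.Computability.Complexity.bip2019_not_hasOccurrenceObstruction_holds n m d hn hd hnm

/-- **Bürgisser 2024, Proposition 7.5** (Kadish–Landsberg 2014; `paper:arxiv-2406.06217`
p0030.txt:L63–66): «Let `f` be a form of degree `m` in `ℓ ≤ n²` variables, and `h := t^{n−m} f`. If
`mult_h(λ) > 0`, then `ℓ(λ) ≤ ℓ + 1` and `λ₁ ≥ |λ|(1 − m/n)`.» PROVED in tree for the case the
survey uses (`f = per_m`, `ℓ = m²`), in tree letters (`per_n` padded inside `det_m`-space, `n ≤ m`,
`|λ| = d·m`, so `|λ|(1 − n/m) = d(m − n)`): every weight occurring in `ℂ[\overline{GL·X₀₀^{m-n} per_n}]`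
is presented by a partition with at most `n² + 1` parts and first part `≥ d(m−n)`
(`Literature.Barriers.ValiantsHypothesis.exists_presentation_long_row_of_hasHighestWeight`, from
the discharged `kadish_landsberg_padding` / BIP Thm. 4.9). Survey-numbered alias; the general-`f`
statement is BIP Thm. 4.9 / Landsberg Prop. 8.4.2.1 (rows BIP19, t01–t02).
[cite: Burgisser2024Completeness, Prop. 7.5] [cite: KadishLandsberg2014, Thm. 1.2] -/
theorem Bur24_prop_7_5_per {n m : ℕ} [NeZero m] (hnm : n ≤ m)
    {χ : Literature.NumberTheory.DiophantineGeometry.Weight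
      (Literature.NumberTheory.DiophantineGeometry.MatIdx m)}
    (h : Literature.NumberTheory.DiophantineGeometry.HasHighestWeight
      (Literature.NumberTheory.DiophantineGeometry.paddedPerOrbitRep ℂ n m) χ) :
    ∃ (d : ℕ) (lam : Nat.Partition (d * m)), lam.parts.card ≤ n ^ 2 + 1 ∧
      d * (m - n) ≤ lam.parts.sup ∧
        χ = Literature.Computability.Complexity.partitionWeightLex m lam :=
  Literature.Barriers.ValiantsHypothesis.exists_presentation_long_row_of_hasHighestWeight hnm h

/-! ### §2.9 Determinantal complexity (CHECK; Def. 2.35 = `determinantalComplexity`) -/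

/-- **Bürgisser 2024, §2.9** (`paper:arxiv-2406.06217` p0012.txt:L85): «It is easy to see that
`dc(2) = 2`.» PROVED here: `per_2 = det [[x₁₁, −x₁₂], [x₂₁, x₂₂]]` (p0012.txt:L63–64) gives `≤ 2`,
and `totalDegree per_2 = 2 ≤ dc` (`totalDegree_le_determinantalComplexity_holds`) gives `≥ 2`.
[cite: Burgisser2024Completeness, §2.9 (dc(2) = 2)] -/
theorem Bur24_dc_two : determinantalComplexity (perPoly (Fin 2) ℂ) = 2 := by
  apply le_antisymm
  · apply determinantalComplexity_le_of_hasDetRepr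
    refine ⟨!![X (0, 0), -X (0, 1); X (1, 0), X (1, 1)], ?_, ?_⟩
    · intro i j
      fin_cases i <;> fin_cases j <;> simp [totalDegree_X]
    · rw [Matrix.det_fin_two]
      simp only [perPoly, Matrix.permanent_fin_two_row, Matrix.mvPolynomialX_apply,
        Matrix.of_apply, Matrix.cons_val', Matrix.cons_val_zero, Matrix.cons_val_one,
        Matrix.cons_val_fin_one, Matrix.empty_val']
      ring
  · have hdeg : (perPoly (Fin 2) ℂ).totalDegree = 2 := by
      simpa using (totalDegree_perPoly_holds (n := Fin 2) (k := ℂ) :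
        (perPoly (Fin 2) ℂ).totalDegree = Fintype.card (Fin 2))
    simpa [hdeg] using totalDegree_le_determinantalComplexity_holds (k := ℂ) (σ := Fin 2 × Fin 2)
      (perPoly (Fin 2) ℂ)

/-- **Bürgisser 2024, §2.9, Grenet's bound** (`paper:arxiv-2406.06217` p0012.txt:L80–82):
«Grenet [grenet:11] showed that `dc(n) ≤ 2^n − 1`». PROVED in tree
(`determinantalComplexity_perPoly_le_holds`, over every field, `n ≥ 1`); survey-numbered alias
over `ℂ`. [cite: Burgisser2024Completeness, §2.9 (Grenet's bound)] [cite: Grenet2011, Thm. 1] -/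
theorem Bur24_dc_le_grenet (n : ℕ) (hn : 1 ≤ n) :
    determinantalComplexity (perPoly (Fin n) ℂ) ≤ 2 ^ n - 1 :=
  determinantalComplexity_perPoly_le_holds ℂ n hn

/-- **Bürgisser 2024, Theorem 2.36** (Mignon–Ressayre 2004; `paper:arxiv-2406.06217`
p0012.txt:L105–106): «We have `dc(n) ≥ n²/2` over `F = ℂ`.» PROVED in tree
(`sq_le_two_mul_determinantalComplexity_perPoly_complex_holds`, stated for `n ≥ 3` as in
Mignon–Ressayre; for `n ≤ 2` the inequality `n² ≤ 2·dc(n)` also holds, `dc(1) = 1`, `dc(2) = 2`),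
rendered without division as `n² ≤ 2·dc(per_n)`. Survey-numbered alias.
[cite: Burgisser2024Completeness, Thm. 2.36] [cite: MignonRessayre2004, Thm. 1.1] -/
theorem Bur24_thm_2_36 {n : ℕ} (hn : 3 ≤ n) :
    n ^ 2 ≤ 2 * determinantalComplexity (perPoly (Fin n) ℂ) :=
  sq_le_two_mul_determinantalComplexity_perPoly_complex_holds hn

/-- **Bürgisser 2024, §2.9, last sentence** (`paper:arxiv-2406.06217` p0012.txt:L109–111): «The
paper [la-ma-res:13] extended this lower bound to the border version of determinantal
complexity» — `\underline{dc}(per_m) ≥ m²/2`. PROVED in tree (`LMR2013_thm_1_1_1_holds`,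
`BorderDcQuadraticBoundProofs.lean`): if `X₀₀^{n−m} per_m ∈ \overline{GL_{n²}·det_n}` with
`m ≤ n` then `m² ≤ 2n`. Survey-locator alias.
[cite: Burgisser2024Completeness, §2.9 (border version)] [cite: LandsbergManivelRessayre2013, Thm. 1.1.1] -/
theorem Bur24_borderDc_quadratic {m n : ℕ} [NeZero n] (hmn : m ≤ n)
    (h : HasBorderDetRepr ℂ m n) : m ^ 2 ≤ 2 * n :=
  LMR2013_thm_1_1_1_holds m n hmn h

/-- **Marcus–Minc 1961, as quoted in Bürgisser 2024, §2.9** (`paper:arxiv-2406.06217`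
p0012.txt:L68–71): «Marcus and Minc strengthened this result by showing that there is no matrix
`[f_pq]` of linear forms `f_pq` in the variables `x_ij` such that `per_n = det[f_pq]`» (`n ≥ 3`,
matrix of size `n`). Typed over `ℂ` (linear form = homogeneous of degree `1`, the zero form
allowed) and PROVED here — not by the 1961 argument but from the tree's determinantal-complexity
bounds: such a matrix is an affine determinantal representation of size `n`, so `dc(per_n) ≤ n`,
contradicting `dc(per_3) = 7`, `dc(per_4) ≥ 9` (Alper–Bogart–Velasco) and `dc(per_n) ≥ n²/2`
(Mignon–Ressayre) for `n ≥ 5`. [cite: MarcusMinc1961, Thm. (as quoted in Burgisser2024Completeness §2.9)]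
[cite: Burgisser2024Completeness, §2.9] -/
theorem Bur24_marcusMinc_complex {n : ℕ} (hn : 3 ≤ n) :
    ¬ ∃ F : Matrix (Fin n) (Fin n) (MvPolynomial (Fin n × Fin n) ℂ),
      (∀ p q, (F p q).IsHomogeneous 1) ∧ F.det = perPoly (Fin n) ℂ := by
  rintro ⟨F, hlin, hdet⟩
  -- a matrix of linear forms is an affine determinantal representation of size `n`
  have hrepr : HasDetRepr (perPoly (Fin n) ℂ) n :=
    ⟨F, fun p q => (hlin p q).totalDegree_le, hdet⟩
  have hdc : determinantalComplexity (perPoly (Fin n) ℂ) ≤ n :=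
    determinantalComplexity_le_of_hasDetRepr hrepr
  have h2 : ringChar ℂ ≠ 2 := by rw [ringChar.eq_zero]; decide
  rcases Nat.lt_or_ge n 5 with hlt | hge
  · -- `n = 3` or `n = 4`
    interval_cases n
    · have h7 : determinantalComplexity (perPoly (Fin 3) ℂ) = 7 :=
        (alperBogartVelasco2017_cor_1_4_holds ℂ h2).1
      omega
    · have h9 : 9 ≤ determinantalComplexity (perPoly (Fin 4) ℂ) :=
        (alperBogartVelasco2017_cor_1_4_holds ℂ h2).2
      omega
  · -- `n ≥ 5`: `n² ≤ 2 dc(per_n) ≤ 2n` is absurd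
    have hmr : n ^ 2 ≤ 2 * determinantalComplexity (perPoly (Fin n) ℂ) :=
      sq_le_two_mul_determinantalComplexity_perPoly_complex_holds (by omega)
    nlinarith


/-! ### Discharge of `Bur24_detOrbitClosure_two` (`Ω_2 = Sym²(ℂ^{2×2})^*`)

Printed argument (Bürgisser 2024 §7.2 states it without proof; standard): a degeneration of the
degree-`2` form `det_2` is a degree-`2` form; conversely a quadratic form `f` in the four matrix
variables over `ℂ` is `vᵀ A v` for a symmetric `A`, which is ᵀ-congruent to a `0/1` diagonal
matrix (tree: `Literature.LinearAlgebra.Matrix.exists_transpose_mul_mul_eq_diagonal_indicator`,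
Horn–Johnson Thm. 4.5.12), so `f = y₁² + y₂² + y₃² + y₄²` with linear forms `y_i` (some possibly
`0`), and `y₁² + y₂² + y₃² + y₄² = (y₁ + i y₂)(y₁ − i y₂) − (−(y₃ + i y₄))(y₃ − i y₄)` is `det_2` after
a (possibly singular) linear substitution, i.e. `f ∈ End·det_2 ⊆ \overline{GL·det_2}`
(`endOrbit_subset_orbitClosure_holds`). -/

section DetOrbitClosureTwo

open scoped _root_.Matrix

/-- Evaluating a linear substitution: `(M · f)(x) = f(Mᵀ x)` (repeated from
`CharacterizedByStabilizerSL.lean`, where it is private). [folklore] -/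
private theorem eval_linSubst_aux {σ : Type*} [Fintype σ] (M : Matrix σ σ ℂ) (x : σ → ℂ)
    (f : MvPolynomial σ ℂ) : eval x (linSubst σ ℂ M f) = eval (Mᵀ *ᵥ x) f := by
  induction f using MvPolynomial.induction_on with
  | C a => rw [linSubst_C, eval_C, eval_C]
  | add p q hp hq => rw [map_add, map_add, map_add, hp, hq]
  | mul_X p i hp =>
    rw [map_mul, map_mul, map_mul, hp, linSubst_X, eval_X]
    simp [Matrix.mulVec, dotProduct, Matrix.transpose_apply, smul_eval, mul_comm]

/-- An exponent vector of degree `2` is `e_s + e_t`. [folklore] -/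
private theorem exists_eq_single_add_single_of_degree_two {σ : Type*} (d : σ →₀ ℕ)
    (hd : d.degree = 2) : ∃ s t : σ, d = Finsupp.single s 1 + Finsupp.single t 1 := by
  classical
  have hne : d ≠ 0 := by
    rintro rfl
    simp at hd
  obtain ⟨s, hs⟩ := Finsupp.ne_iff.mp hne
  simp only [Finsupp.coe_zero, Pi.zero_apply] at hs
  set d' := d - Finsupp.single s 1 with hd'
  have hsplit : d = d' + Finsupp.single s 1 := by
    rw [hd', tsub_add_cancel_of_le]
    exact Finsupp.single_le_iff.mpr (Nat.one_le_iff_ne_zero.mpr hs)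
  have hdeg' : d'.degree = 1 := by
    have := congrArg Finsupp.degree hsplit
    rw [map_add, Finsupp.degree_single, hd] at this
    omega
  have hne' : d' ≠ 0 := by
    intro h
    rw [h] at hdeg'
    simp at hdeg'
  obtain ⟨t, ht⟩ := Finsupp.ne_iff.mp hne'
  simp only [Finsupp.coe_zero, Pi.zero_apply] at ht
  set d'' := d' - Finsupp.single t 1 with hd''
  have hsplit' : d' = d'' + Finsupp.single t 1 := by
    rw [hd'', tsub_add_cancel_of_le]
    exact Finsupp.single_le_iff.mpr (Nat.one_le_iff_ne_zero.mpr ht)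
  have hdeg'' : d''.degree = 0 := by
    have := congrArg Finsupp.degree hsplit'
    rw [map_add, Finsupp.degree_single, hdeg'] at this
    omega
  have h0 : d'' = 0 := (Finsupp.degree_eq_zero_iff _).mp hdeg''
  refine ⟨t, s, ?_⟩
  rw [hsplit, hsplit', h0, zero_add]

/-- The quadratic function of the elementary symmetric pattern: `vᵀ E_{st} v = v_s v_t`. [folklore] -/
private theorem dotProduct_patternMulVec {σ : Type*} [Fintype σ] [DecidableEq σ] (s t : σ)
    (v : σ → ℂ) :
    v ⬝ᵥ ((Matrix.of fun i j => if i = s ∧ j = t then (1 : ℂ) else 0) *ᵥ v) = v s * v t := by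
  have inner : ∀ i : σ, (∑ j, (if i = s ∧ j = t then (1 : ℂ) else 0) * v j) =
      if i = s then v t else 0 := by
    intro i
    by_cases hi : i = s
    · simp [hi, ite_mul, Finset.sum_ite_eq']
    · simp [hi]
  simp only [dotProduct, Matrix.mulVec, Matrix.of_apply]
  simp_rw [inner]
  simp [mul_ite, Finset.sum_ite_eq']

/-- A homogeneous polynomial of degree `2` over `ℂ` is the quadratic function of a symmetric
matrix. [folklore] -/
private theorem exists_isSymm_eval_eq_of_isHomogeneous_two {σ : Type*} [Fintype σ]
    [DecidableEq σ] {f : MvPolynomial σ ℂ} (hf : f.IsHomogeneous 2) :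
    ∃ A : Matrix σ σ ℂ, A.IsSymm ∧ ∀ v : σ → ℂ, eval v f = v ⬝ᵥ (A *ᵥ v) := by
  classical
  -- monomials of degree 2
  have key : ∀ d : σ →₀ ℕ, d.degree = 2 → ∀ c : ℂ, ∃ A : Matrix σ σ ℂ, A.IsSymm ∧
      ∀ v : σ → ℂ, eval v (monomial d c) = v ⬝ᵥ (A *ᵥ v) := by
    intro d hd c
    obtain ⟨s, t, rfl⟩ := exists_eq_single_add_single_of_degree_two d hd
    set E : Matrix σ σ ℂ := Matrix.of fun i j => if i = s ∧ j = t then (1 : ℂ) else 0 with hE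
    refine ⟨(c / 2) • (E + Eᵀ), (Matrix.isSymm_add_transpose_self E).smul (c / 2), fun v => ?_⟩
    have h1 : v ⬝ᵥ (E *ᵥ v) = v s * v t := dotProduct_patternMulVec s t v
    have h2 : v ⬝ᵥ (Eᵀ *ᵥ v) = v s * v t := by
      rw [Matrix.dotProduct_mulVec, Matrix.vecMul_transpose, dotProduct_comm, h1]
    rw [Matrix.smul_mulVec, dotProduct_smul, Matrix.add_mulVec, dotProduct_add, h1, h2,
      eval_monomial, Finsupp.prod_add_index' (by simp) (by simp [pow_add]),
      Finsupp.prod_single_index (by simp), Finsupp.prod_single_index (by simp)]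
    simp only [pow_one, smul_eq_mul]
    ring
  -- finite sums of such
  have hsum : ∀ S : Finset (σ →₀ ℕ), (∀ d ∈ S, d.degree = 2) →
      ∃ A : Matrix σ σ ℂ, A.IsSymm ∧
        ∀ v : σ → ℂ, eval v (∑ d ∈ S, monomial d (coeff d f)) = v ⬝ᵥ (A *ᵥ v) := by
    intro S
    induction S using Finset.induction_on with
    | empty => intro _; exact ⟨0, Matrix.isSymm_zero, fun v => by simp⟩
    | insert d S hdS ih =>
      intro hS
      obtain ⟨A₁, hA₁, h₁⟩ := key d (hS d (Finset.mem_insert_self _ _)) (coeff d f)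
      obtain ⟨A₂, hA₂, h₂⟩ := ih fun d' hd' => hS d' (Finset.mem_insert_of_mem hd')
      refine ⟨A₁ + A₂, hA₁.add hA₂, fun v => ?_⟩
      rw [Finset.sum_insert hdS, map_add, h₁, h₂, Matrix.add_mulVec, dotProduct_add]
  obtain ⟨A, hA, h⟩ := hsum f.support fun d hd => by
    rw [Finsupp.degree_eq_weight_one]
    exact hf (mem_support_iff.mp hd)
  exact ⟨A, hA, fun v => by rw [← h v, ← f.as_sum]⟩

/-- **Discharge of `Bur24_detOrbitClosure_two`** (Bürgisser 2024 §7.2: `Ω_2 = Sym²(ℂ^{2×2})^*`):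
the orbit closure of `det_2` is the set of all quadratic forms in the four matrix variables.
`⊆`: degenerations of a degree-`2` form are degree-`2` forms
(`MvPolynomial.IsHomogeneous.of_mem_orbitClosure`). `⊇`: write `f(v) = vᵀAv` with `A` symmetric,
ᵀ-congruent to a `0/1`-diagonal matrix (`exists_transpose_mul_mul_eq_diagonal_indicator`), so
`f = Σ_i y_i²` with four linear forms `y_i`, `= (y₁ + iy₂)(y₁ − iy₂) − (−(y₃ + iy₄))(y₃ − iy₄)`, a
linear substitution of `det_2 = x₀₀x₁₁ − x₀₁x₁₀`; conclude by `endOrbit_subset_orbitClosure_holds`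
and `MvPolynomial.funext`. [cite: Burgisser2024Completeness, §7.2 (remark before Thm. 7.2)] -/
theorem Bur24_detOrbitClosure_two_holds : Bur24_detOrbitClosure_two := by
  classical
  apply Set.Subset.antisymm
  · intro g hg
    have h := (detPoly_isHomogeneous (n := Fin 2) (k := ℂ)).of_mem_orbitClosure hg
    simpa using h
  · intro f hf
    have hf' : f.IsHomogeneous 2 := hf
    -- (a) `f(v) = vᵀ A v`, `A` symmetric
    obtain ⟨A, hA, hAeval⟩ := exists_isSymm_eval_eq_of_isHomogeneous_two hf'
    -- (b) `Mᵀ A M = diag(𝟙_s)` with `M` invertible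
    have hsq : ∀ a : ℂ, IsSquare a := fun a => by
      obtain ⟨z, hz⟩ := IsAlgClosed.exists_pow_nat_eq a (by norm_num : 0 < 2)
      exact ⟨z, by rw [← hz]; ring⟩
    obtain ⟨M, s, hMunit, hMAM⟩ :=
      Literature.LinearAlgebra.Matrix.exists_transpose_mul_mul_eq_diagonal_indicator hsq
        two_ne_zero hA
    set N : Matrix (Fin 2 × Fin 2) (Fin 2 × Fin 2) ℂ := M⁻¹ with hN
    have hMN : M * N = 1 := M.mul_nonsing_inv hMunit
    have hAeq : A = Nᵀ * Matrix.diagonal (fun i => if i ∈ s then (1 : ℂ) else 0) * N := by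
      calc A = (M * N)ᵀ * A * (M * N) := by rw [hMN]; simp
        _ = Nᵀ * (Mᵀ * A * M) * N := by rw [Matrix.transpose_mul]; simp only [Matrix.mul_assoc]
        _ = _ := by rw [hMAM]
    -- (c) `f(v) = Σ_i (Y i v)²` with the linear forms `Y i = (r i) ⬝ v`
    set r : Fin 2 × Fin 2 → Fin 2 × Fin 2 → ℂ := fun i => if i ∈ s then N i else 0 with hr
    have hfeval : ∀ v : Fin 2 × Fin 2 → ℂ, eval v f = ∑ i, (r i ⬝ᵥ v) ^ 2 := by
      intro v
      rw [hAeval v, hAeq, ← Matrix.mulVec_mulVec, ← Matrix.mulVec_mulVec, Matrix.dotProduct_mulVec,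
        Matrix.vecMul_transpose]
      simp only [dotProduct, Matrix.mulVec_diagonal]
      refine Finset.sum_congr rfl fun i _ => ?_
      by_cases hi : i ∈ s
      · simp only [hr, hi, if_true]
        simp only [Matrix.mulVec, dotProduct]
        ring
      · simp [hr, hi]
    -- (d) the substitution matrix: columns = coefficient vectors of the four linear forms
    set col : Fin 2 × Fin 2 → Fin 2 × Fin 2 → ℂ := fun i =>
      if i = (0, 0) then r (0, 0) + Complex.I • r (0, 1)
      else if i = (1, 1) then r (0, 0) - Complex.I • r (0, 1)
      else if i = (0, 1) then -(r (1, 0) + Complex.I • r (1, 1))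
      else r (1, 0) - Complex.I • r (1, 1) with hcol
    set B : Matrix (Fin 2 × Fin 2) (Fin 2 × Fin 2) ℂ := Matrix.of fun j i => col i j with hB
    have hBt : ∀ v : Fin 2 × Fin 2 → ℂ, ∀ i, (Bᵀ *ᵥ v) i = col i ⬝ᵥ v := by
      intro v i
      simp [hB, Matrix.mulVec, dotProduct, Matrix.transpose_apply, Matrix.of_apply]
    have hdet : ∀ v : Fin 2 × Fin 2 → ℂ, eval v (linSubst (Fin 2 × Fin 2) ℂ B (detPoly (Fin 2) ℂ)) =
        (col (0, 0) ⬝ᵥ v) * (col (1, 1) ⬝ᵥ v) - (col (0, 1) ⬝ᵥ v) * (col (1, 0) ⬝ᵥ v) := by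
      intro v
      rw [eval_linSubst_aux, eval_detPoly, Matrix.det_fin_two]
      simp only [Matrix.of_apply, hBt]
    have hident : ∀ v : Fin 2 × Fin 2 → ℂ,
        eval v (linSubst (Fin 2 × Fin 2) ℂ B (detPoly (Fin 2) ℂ)) = eval v f := by
      intro v
      rw [hdet, hfeval, Fintype.sum_prod_type]
      simp only [Fin.sum_univ_two, hcol]
      simp only [Fin.isValue, Prod.mk.injEq, zero_ne_one, one_ne_zero, and_true, and_false,
        and_self, if_true, if_false, add_dotProduct, sub_dotProduct, neg_dotProduct,
        smul_dotProduct, smul_eq_mul]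
      linear_combination (-(r (0, 1) ⬝ᵥ v) ^ 2 - (r (1, 1) ⬝ᵥ v) ^ 2) * Complex.I_sq
    -- (e) conclude
    have hfB : f = linSubst (Fin 2 × Fin 2) ℂ B (detPoly (Fin 2) ℂ) :=
      MvPolynomial.funext fun v => (hident v).symm
    have hmem : f ∈ endOrbit (Fin 2 × Fin 2) ℂ (detPoly (Fin 2) ℂ) := ⟨B, hfB.symm⟩
    exact endOrbit_subset_orbitClosure_holds (detPoly (Fin 2) ℂ) hmem

end DetOrbitClosureTwo

end Literature.Computability.AlgebraicComplexity
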